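import Literature.AlgebraicGeometry.HodgeTheory.BettiIrregularityHodgeTateType
import HarnessLib

/-!
# The Hodge–Tate criterion reduced to the fundamental triangle of the Hodge diamond: `h^{p,q}(X) = 0` for `p < q ≤ n`, `p + q ≤ n` suffices;
# curves of genus `0`, surfaces with `p_g = q = 0`, threefolds with `h^{1,0} = h^{2,0} = h^{3,0} = h^{1,2} = 0`
# (Voisin I Cor. 6.12–6.13, Thm. 6.25, proof of Thm. 6.33; Voisin II §11.1.1; Green–Griffiths–Kerr §I.C p. 45)

Family `hodge`, lane `lit-hodgefound` (Track 2 foundations library; Layers A1/A4), layer `Literature/AlgebraicGeometry/HodgeTheory`.  THEOREMS ONLY (no definition,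
no named fact, no instance; D-0026 net debt `0`).  Sequel of the seat's g24-#6 `BettiIrregularityHodgeTateType`: the Hodge–Tate hypothesis «`h^{p,q}(X) = 0` for all
`p ≠ q`» (infinitely many indices `(k, p, q)`) is REDUCED, by Hodge symmetry `h^{p,q} = h^{q,p}` (Voisin I Cor. 6.12), the Serre–Poincaré duality
`h^{p,q}(H^{p+q}) = h^{n−p,n−q}(H^{2n−p−q})` (g24-#4/#5; Voisin I proof of Thm. 6.33) and the vanishing of `h^{p,q}` for `p > n` or `q > n`, to the FINITELY MANY
numbers of the fundamental triangle `p < q ≤ n`, `p + q ≤ n` of the Hodge diamond.  Low dimensions: a curve is of Hodge–Tate type iff its genus `h^{1,0}` is `0`; a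
surface iff `q = p_g = 0` (g24-#6's §3 recovered without case analysis); a threefold iff `h^{1,0} = h^{2,0} = h^{3,0} = h^{1,2} = 0` (e.g. `ℙ³`, quadrics, the Fano
threefolds `V₅`, `V₂₂`), and then ALL its Hodge groups are trivial, its odd cohomology vanishes and `H²`, `H⁴` consist of algebraic classes.

THE PRINTS.  C. Voisin (2002) [VoisinHodgeI2002] §6.1.3 Cor. 6.12, Cor. 6.13, §6.2.3 Thm. 6.25, §6.3.2 proof of Thm. 6.33 (PDF p0129) «we used Poincaré duality here»,
§11.1.2 Prop. 11.20 (the class of an analytic cycle is of type `(p,p)`), Thm. 11.30, §11.3.1 Def. 11.28 (PDF p0231).  C. Voisin (2003) [VoisinHodgeII2003] §11.1.1 (PDF p0268) («`p_g(X) := dim H^{2,0}(X)`», «`q(X) := dim H^{1,0}(X)`»).  M. Green, P. Griffiths, M. Kerr (2012)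
[GreenGriffithsKerr2012] §I.A p0033 («Hodge-Tate structure»), §I.C p0045 («since `V_ℂ = ⊕_p V^{p,p}`, `φ` is trivial and so `M_φ = {1}`»).  J. Carlson,
S. Müller-Stach, C. Peters (2017) [CarlsonMullerStachPeters2017] §15.2 Examples 15.2.4 (i) (p0369).  M. Kerr, G. Pearlstein (2011) [KerrPearlstein2011] §3.1.

THE OBJECTS (all the tree's).  `X : SchemeOver ℂ`, `hX : IsSmoothProjective n X`, `hHD : exists_isReal_hodgeModel`; `Hᵏ(X) = BettiUniverse.hodge hHD hX k` with
`hodgeNumber`, `hodgeGroupBaseChange K`; `bettiCohomology X k`; `algebraicClasses X p`; `ofRatClass`.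

WHAT IS PROVED.
* §1 **`BettiUniverse.hodgeTateType_of_forall_lt`** (the reduction: `h^{p,q}(H^{p+q}(X)) = 0` for `p < q ≤ n`, `p + q ≤ n` ⟹ `h^{p,q}(Hᵏ(X)) = 0` for all `p + q = k`,
  `p ≠ q`), `BettiUniverse.hodgeTateType_iff_forall_lt`.
* §2 CURVES: `BettiUniverse.hodgeTateType_of_curve_genus_zero` (`h^{1,0} = 0 ⟹` Hodge–Tate), `BettiUniverse.finrank_bettiCohomology_one_eq_zero_of_curve_genus_zero`.
* §3 SURFACES: `BettiUniverse.hodgeTateType_of_surface_pg_q_zero'` (g24-#6 §3 through §1, no case analysis).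
* §4 THREEFOLDS: **`BettiUniverse.hodgeTateType_of_threefold`** (`h^{1,0} = h^{2,0} = h^{3,0} = h^{1,2} = 0 ⟹` Hodge–Tate type),
  `BettiUniverse.hodgeGroupBaseChange_hodge_eq_bot_of_threefold` (all `Hg(H^{2p}(X))(K) = 1`), `BettiUniverse.finrank_bettiCohomology_eq_zero_of_threefold` (`H¹ = H³ = H⁵ = 0`
  rationally), `ofRatClass_mem_algebraicClasses_one_of_threefold` / `_two_of_threefold` (`H²(X; ℚ)` divisor classes, `H⁴(X; ℚ)` curve classes).
* §5 THE CONVERSE CRITERION — COHOMOLOGY SPANNED BY ALGEBRAIC CLASSES IS PURE: **`BettiUniverse.hodgeClasses_hodge_eq_top_of_forall_mem_algebraicClasses`** (if every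
  `v ∈ H^{2p}(X(ℂ); ℚ)` has `v ⊗ 1 ∈ NᵖH^{2p}` then `Hdgᵖ(H^{2p}(X)) = ⊤`; algebraic classes are of type `(p,p)`, Voisin I Prop. 11.20, the tree's
  `isOfHodgeType_of_mem_algebraicClasses_of_isSmoothProjective`), `BettiUniverse.hodgeGroupBaseChange_hodge_eq_bot_of_forall_mem_algebraicClasses` (then `Hg(H^{2p}(X))(K) = 1`),
  and the EQUIVALENCES in the two Lefschetz degrees: **`forall_ofRatClass_mem_algebraicClasses_one_iff_pg_zero`** (`H²(X; ℚ)` is all divisor classes `⟺ p_g(X) = 0`),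
  `forall_ofRatClass_mem_algebraicClasses_curveDegree_iff_pg_zero` (`H^{2n−2}(X; ℚ)` is all curve classes `⟺ p_g(X) = 0`, `n ≥ 1`).

DEVIATIONS / SCOPE.  Hypotheses on Hodge numbers only; no particular threefold is treated.

## References
* [VoisinHodgeI2002] C. Voisin, *Hodge Theory and Complex Algebraic Geometry I* (2002) — §6.1.3 Cor. 6.12–6.13, §6.2.3 Thm. 6.25, §6.3.2 proof of Thm. 6.33 (PDF p. 129), §11.1.2
  Prop. 11.20, Thm. 11.30, §11.3.1 Def. 11.28.
* [VoisinHodgeII2003] C. Voisin, *Hodge Theory and Complex Algebraic Geometry II* (2003) — §11.1.1 (PDF p. 268).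
* [GreenGriffithsKerr2012] M. Green, P. A. Griffiths, M. Kerr, *Mumford–Tate Groups and Domains* (2012) — §I.A p. 33, §I.C p. 45.
* [CarlsonMullerStachPeters2017] J. Carlson, S. Müller-Stach, C. Peters, *Period Mappings and Period Domains*, 2nd ed. (2017) — §15.2 Examples 15.2.4 (i) (p. 369).
* [KerrPearlstein2011] M. Kerr, G. Pearlstein (2011) — §3.1.

## Provenance
Lane `lit-hodgefound` (Hodge path, Track 2), prover seat `lit-hodgefound-p29` (generation 24), self-proposed row g24-#7 (reduction of g24-#6's hypothesis).
-/

noncomputable section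

open scoped TensorProduct
open CategoryTheory Module
open Literature.AlgebraicTopology.SingularHomology

namespace Literature.AlgebraicGeometry.HodgeTheory

open Literature.AlgebraicGeometry.Motives
open Literature.AlgebraicGeometry.Motives.HodgeStructure

universe w

variable {n : ℕ} {X : SchemeOver ℂ}

/-! ### §1 The reduction to the fundamental triangle `p < q ≤ n`, `p + q ≤ n` -/

/-- **Hodge–Tate type is decided on the fundamental triangle**: if `h^{p,q}(H^{p+q}(X)) = 0` whenever `p < q ≤ n` and `p + q ≤ n`, then `h^{p,q}(Hᵏ(X)) = 0` for
ALL `p + q = k` with `p ≠ q` (Hodge symmetry handles `q < p`; indices `> n` give `0`; `p + q > n` is reflected to `(n−q, n−p)` with `2n − p − q < n` by Serre–Poincaré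
duality). [cite: VoisinHodgeI2002, §6.1.3 Cor. 6.12 and §6.3.2 proof of Thm. 6.33 (PDF p. 129)] -/
theorem BettiUniverse.hodgeTateType_of_forall_lt (hHD : exists_isReal_hodgeModel) (hX : IsSmoothProjective n X)
    (h : ∀ p q : ℕ, p < q → q ≤ n → p + q ≤ n → (BettiUniverse.hodge hHD hX (p + q)).hodgeNumber p q = 0) :
    ∀ k p q : ℕ, p + q = k → p ≠ q → (BettiUniverse.hodge hHD hX k).hodgeNumber p q = 0 := by
  -- first, the triangle condition without the restriction `p + q ≤ n`
  have h' : ∀ p q : ℕ, p < q → q ≤ n → (BettiUniverse.hodge hHD hX (p + q)).hodgeNumber p q = 0 := by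
    intro p q hpq hqn
    by_cases hs : p + q ≤ n
    · exact h p q hpq hqn hs
    · rw [BettiUniverse.hodgeNumber_hodge_duality_of_eq hHD hX (k' := (n - p) + (n - q)) (a' := n - p) (b' := n - q) rfl rfl (by omega) (by omega),
        BettiUniverse.hodgeNumber_hodge_symm hHD hX ((n - p) + (n - q)) (n - p : ℕ) (n - q : ℕ)]
      have := h (n - q) (n - p) (by omega) (by omega) (by omega)
      rwa [show n - q + (n - p) = n - p + (n - q) by omega] at this
  intro k p q hpq hne
  subst hpq
  by_cases hp : n < p
  · exact BettiUniverse.hodgeNumber_hodge_eq_zero_of_lt_fst hHD hX rfl hp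
  by_cases hq : n < q
  · exact BettiUniverse.hodgeNumber_hodge_eq_zero_of_lt_snd hHD hX rfl hq
  rcases lt_or_gt_of_ne hne with hlt | hlt
  · exact h' p q hlt (by omega)
  · rw [BettiUniverse.hodgeNumber_hodge_symm hHD hX (p + q) p q]
    have := h' q p hlt (by omega)
    rwa [Nat.add_comm q p] at this

/-- **Hodge–Tate type ⟺ the fundamental-triangle numbers vanish.** [cite: VoisinHodgeI2002, §6.1.3 Cor. 6.12 and §6.3.2 proof of Thm. 6.33 (PDF p. 129)] -/
theorem BettiUniverse.hodgeTateType_iff_forall_lt (hHD : exists_isReal_hodgeModel) (hX : IsSmoothProjective n X) :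
    (∀ k p q : ℕ, p + q = k → p ≠ q → (BettiUniverse.hodge hHD hX k).hodgeNumber p q = 0) ↔
      ∀ p q : ℕ, p < q → q ≤ n → p + q ≤ n → (BettiUniverse.hodge hHD hX (p + q)).hodgeNumber p q = 0 :=
  ⟨fun hHT p q hpq _ _ => hHT (p + q) p q rfl hpq.ne, BettiUniverse.hodgeTateType_of_forall_lt hHD hX⟩

/-! ### §2 Curves: genus `0` -/

/-- **A smooth projective curve with `h^{1,0} = 0` (genus `0`) is of Hodge–Tate type** (the triangle is the single number `h^{0,1} = h^{1,0}`).
[cite: VoisinHodgeI2002, §6.1.3 Cor. 6.12 and Cor. 6.13] -/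
theorem BettiUniverse.hodgeTateType_of_curve_genus_zero (hHD : exists_isReal_hodgeModel) (hX : IsSmoothProjective 1 X)
    (h10 : (BettiUniverse.hodge hHD hX 1).hodgeNumber 1 0 = 0) : ∀ k p q : ℕ, p + q = k → p ≠ q → (BettiUniverse.hodge hHD hX k).hodgeNumber p q = 0 := by
  refine BettiUniverse.hodgeTateType_of_forall_lt hHD hX fun p q hpq hq1 hs => ?_
  obtain rfl : p = 0 := by omega
  obtain rfl : q = 1 := by omega
  rw [BettiUniverse.hodgeNumber_hodge_symm hHD hX (0 + 1) (0 : ℕ) (1 : ℕ)]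
  exact_mod_cast h10

/-- **Genus `0 ⟹ H¹(C(ℂ); ℚ) = 0`.** [cite: VoisinHodgeI2002, §6.1.3 Cor. 6.13] -/
theorem BettiUniverse.finrank_bettiCohomology_one_eq_zero_of_curve_genus_zero (hHD : exists_isReal_hodgeModel) (hX : IsSmoothProjective 1 X)
    (h10 : (BettiUniverse.hodge hHD hX 1).hodgeNumber 1 0 = 0) : Module.finrank ℚ (bettiCohomology X 1) = 0 :=
  (BettiUniverse.finrank_bettiCohomology_one_eq_zero_iff hHD hX).2 h10

/-! ### §3 Surfaces: `p_g = q = 0`, through the reduction -/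

/-- **Surfaces with `p_g = q = 0` are of Hodge–Tate type** — g24-#6's `hodgeTateType_of_surface_pg_q_zero` recovered from §1 (triangle = `h^{0,1}`, `h^{0,2}`).
[cite: VoisinHodgeII2003, §11.1.1 (PDF p. 268)] [cite: VoisinHodgeI2002, §6.1.3 Cor. 6.12] -/
theorem BettiUniverse.hodgeTateType_of_surface_pg_q_zero' (hHD : exists_isReal_hodgeModel) (hX : IsSmoothProjective 2 X)
    (h10 : (BettiUniverse.hodge hHD hX 1).hodgeNumber 1 0 = 0) (h20 : (BettiUniverse.hodge hHD hX 2).hodgeNumber 2 0 = 0) :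
    ∀ k p q : ℕ, p + q = k → p ≠ q → (BettiUniverse.hodge hHD hX k).hodgeNumber p q = 0 := by
  refine BettiUniverse.hodgeTateType_of_forall_lt hHD hX fun p q hpq hq2 hs => ?_
  obtain rfl : p = 0 := by omega
  rw [BettiUniverse.hodgeNumber_hodge_symm hHD hX (0 + q) (0 : ℕ) (q : ℕ)]
  rcases Nat.lt_or_ge q 2 with hq | hq
  · obtain rfl : q = 1 := by omega
    exact_mod_cast h10
  · obtain rfl : q = 2 := by omega
    exact_mod_cast h20

/-! ### §4 Threefolds: `h^{1,0} = h^{2,0} = h^{3,0} = h^{1,2} = 0` -/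

section Threefold

variable (hX : IsSmoothProjective 3 X)

/-- **A smooth projective threefold with `h^{1,0} = h^{2,0} = h^{3,0} = h^{1,2} = 0` is of Hodge–Tate type** (the triangle `p < q ≤ 3`, `p + q ≤ 3` consists of
`(0,1)`, `(0,2)`, `(0,3)`, `(1,2)`). [cite: VoisinHodgeI2002, §6.1.3 Cor. 6.12 and §6.3.2 proof of Thm. 6.33 (PDF p. 129)] [cite: GreenGriffithsKerr2012, §I.A p. 33] -/
theorem BettiUniverse.hodgeTateType_of_threefold (hHD : exists_isReal_hodgeModel) (h10 : (BettiUniverse.hodge hHD hX 1).hodgeNumber 1 0 = 0)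
    (h20 : (BettiUniverse.hodge hHD hX 2).hodgeNumber 2 0 = 0) (h30 : (BettiUniverse.hodge hHD hX 3).hodgeNumber 3 0 = 0)
    (h12 : (BettiUniverse.hodge hHD hX 3).hodgeNumber 1 2 = 0) : ∀ k p q : ℕ, p + q = k → p ≠ q → (BettiUniverse.hodge hHD hX k).hodgeNumber p q = 0 := by
  refine BettiUniverse.hodgeTateType_of_forall_lt hHD hX fun p q hpq hq3 hs => ?_
  rcases Nat.eq_zero_or_pos p with rfl | hp
  · rw [BettiUniverse.hodgeNumber_hodge_symm hHD hX (0 + q) (0 : ℕ) (q : ℕ)]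
    rcases Nat.lt_or_ge q 2 with hq | hq
    · obtain rfl : q = 1 := by omega
      exact_mod_cast h10
    · rcases Nat.lt_or_ge q 3 with hq' | hq'
      · obtain rfl : q = 2 := by omega
        exact_mod_cast h20
      · obtain rfl : q = 3 := by omega
        exact_mod_cast h30
  · obtain rfl : p = 1 := by omega
    obtain rfl : q = 2 := by omega
    exact_mod_cast h12

/-- **Such a threefold has all Hodge groups `Hg(H^{2p}(X))(K)` trivial**, every field `K ⊇ ℚ`. [cite: GreenGriffithsKerr2012, §I.C p. 45 (before Remark (I.C.14))]
[cite: CarlsonMullerStachPeters2017, §15.2 Examples 15.2.4 (i) (p. 369)] -/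
theorem BettiUniverse.hodgeGroupBaseChange_hodge_eq_bot_of_threefold [HodgeTensorFacts.{0, 0}] (hHD : exists_isReal_hodgeModel) (K : Type w) [Field K] [Algebra ℚ K]
    (h10 : (BettiUniverse.hodge hHD hX 1).hodgeNumber 1 0 = 0) (h20 : (BettiUniverse.hodge hHD hX 2).hodgeNumber 2 0 = 0)
    (h30 : (BettiUniverse.hodge hHD hX 3).hodgeNumber 3 0 = 0) (h12 : (BettiUniverse.hodge hHD hX 3).hodgeNumber 1 2 = 0) (p : ℕ)
    [Module.Finite ℚ (bettiCohomology X (2 * p))] : (BettiUniverse.hodge hHD hX (2 * p)).hodgeGroupBaseChange K = ⊥ :=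
  BettiUniverse.hodgeGroupBaseChange_hodge_eq_bot_of_hodgeTateType hHD hX K (BettiUniverse.hodgeTateType_of_threefold hX hHD h10 h20 h30 h12) p

/-- **… and no odd rational cohomology**: `H¹ = H³ = H⁵ = 0` over `ℚ`. [cite: VoisinHodgeI2002, §6.1.3 Cor. 6.13] -/
theorem BettiUniverse.finrank_bettiCohomology_eq_zero_of_threefold (hHD : exists_isReal_hodgeModel)
    (h10 : (BettiUniverse.hodge hHD hX 1).hodgeNumber 1 0 = 0) (h20 : (BettiUniverse.hodge hHD hX 2).hodgeNumber 2 0 = 0)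
    (h30 : (BettiUniverse.hodge hHD hX 3).hodgeNumber 3 0 = 0) (h12 : (BettiUniverse.hodge hHD hX 3).hodgeNumber 1 2 = 0) {k : ℕ} (hk : Odd k) :
    Module.finrank ℚ (bettiCohomology X k) = 0 :=
  BettiUniverse.finrank_bettiCohomology_eq_zero_of_hodgeTateType hHD hX (BettiUniverse.hodgeTateType_of_threefold hX hHD h10 h20 h30 h12) hk

/-- **… `H²(X(ℂ); ℚ)` consists of divisor classes** (Lefschetz `(1,1)`). [cite: VoisinHodgeI2002, Thm. 11.30 and §11.3.3] -/
theorem ofRatClass_mem_algebraicClasses_one_of_threefold (hHD : exists_isReal_hodgeModel)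
    (h10 : (BettiUniverse.hodge hHD hX 1).hodgeNumber 1 0 = 0) (h20 : (BettiUniverse.hodge hHD hX 2).hodgeNumber 2 0 = 0)
    (h30 : (BettiUniverse.hodge hHD hX 3).hodgeNumber 3 0 = 0) (h12 : (BettiUniverse.hodge hHD hX 3).hodgeNumber 1 2 = 0) (v : bettiCohomology X 2) :
    ofRatClass (ComplexPoints X) 2 v ∈ algebraicClasses X 1 :=
  ofRatClass_mem_algebraicClasses_one_of_hodgeTateType hHD hX (BettiUniverse.hodgeTateType_of_threefold hX hHD h10 h20 h30 h12) v

/-- **… and `H⁴(X(ℂ); ℚ)` consists of curve classes** (degree `2n − 2 = 4`). [cite: KerrPearlstein2011, §3.1] [cite: VoisinHodgeI2002, Thm. 6.25 and Thm. 11.30] -/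
theorem ofRatClass_mem_algebraicClasses_two_of_threefold (hHD : exists_isReal_hodgeModel)
    (h10 : (BettiUniverse.hodge hHD hX 1).hodgeNumber 1 0 = 0) (h20 : (BettiUniverse.hodge hHD hX 2).hodgeNumber 2 0 = 0)
    (h30 : (BettiUniverse.hodge hHD hX 3).hodgeNumber 3 0 = 0) (h12 : (BettiUniverse.hodge hHD hX 3).hodgeNumber 1 2 = 0) (v : bettiCohomology X (2 * (3 - 1))) :
    ofRatClass (ComplexPoints X) (2 * (3 - 1)) v ∈ algebraicClasses X (3 - 1) :=
  ofRatClass_mem_algebraicClasses_curveDegree_of_hodgeTateType hHD hX (by norm_num) (BettiUniverse.hodgeTateType_of_threefold hX hHD h10 h20 h30 h12) v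

end Threefold

/-! ### §5 The converse criterion: cohomology spanned by algebraic classes is purely of type `(p,p)` -/

/-- **If every class of `H^{2p}(X(ℂ); ℚ)` is algebraic then `H^{2p}(X)` is purely of type `(p,p)`**: `Hdgᵖ(H^{2p}(X)) = ⊤` (the class of an algebraic cycle is a
Hodge class — Voisin I Prop. 11.20, the tree's `isOfHodgeType_of_mem_algebraicClasses_of_isSmoothProjective` — and the dictionary of g24-#1).
[cite: VoisinHodgeI2002, §11.1.2 Prop. 11.20 and §11.3.1 Def. 11.28] -/
theorem BettiUniverse.hodgeClasses_hodge_eq_top_of_forall_mem_algebraicClasses (hHD : exists_isReal_hodgeModel) (hX : IsSmoothProjective n X) (p : ℕ)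
    (h : ∀ v : bettiCohomology X (2 * p), ofRatClass (ComplexPoints X) (2 * p) v ∈ algebraicClasses X p) :
    (BettiUniverse.hodge hHD hX (2 * p)).hodgeClasses p = ⊤ :=
  eq_top_iff.2 fun v _ => (BettiUniverse.mem_hodgeClasses_hodge_iff_isOfHodgeType hHD hX p v).2
    (isOfHodgeType_of_mem_algebraicClasses_of_isSmoothProjective hX p (h v))

/-- **… hence `Hg(H^{2p}(X))(K) = 1`** for every field `K ⊇ ℚ`: a cohomology group spanned by algebraic cycle classes has trivial Hodge group (and, in weight `≠ 0`,
Mumford–Tate group `𝔾_m` on points, g24-#2). [cite: GreenGriffithsKerr2012, §I.C p. 45 (before Remark (I.C.14))] [cite: VoisinHodgeI2002, §11.1.2 Prop. 11.20] -/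
theorem BettiUniverse.hodgeGroupBaseChange_hodge_eq_bot_of_forall_mem_algebraicClasses [HodgeTensorFacts.{0, 0}] (hHD : exists_isReal_hodgeModel)
    (hX : IsSmoothProjective n X) (K : Type w) [Field K] [Algebra ℚ K] (p : ℕ) [Module.Finite ℚ (bettiCohomology X (2 * p))]
    (h : ∀ v : bettiCohomology X (2 * p), ofRatClass (ComplexPoints X) (2 * p) v ∈ algebraicClasses X p) :
    (BettiUniverse.hodge hHD hX (2 * p)).hodgeGroupBaseChange K = ⊥ :=
  (BettiUniverse.hodge hHD hX (2 * p)).hodgeGroupBaseChange_eq_bot_of_hodgeClasses_eq_top K (p := (p : ℤ)) (by push_cast; ring)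
    (BettiUniverse.hodgeClasses_hodge_eq_top_of_forall_mem_algebraicClasses hHD hX p h)

/-- **`H²(X(ℂ); ℚ)` consists of divisor classes ⟺ `p_g(X) = 0`** (⟸: g24-#3, Lefschetz `(1,1)`; ⟹: divisor classes are of type `(1,1)`).
[cite: VoisinHodgeI2002, §11.1.2 Prop. 11.20 and Thm. 11.30] [cite: VoisinHodgeII2003, §11.1.1 (PDF p. 268)] -/
theorem forall_ofRatClass_mem_algebraicClasses_one_iff_pg_zero (hHD : exists_isReal_hodgeModel) (hX : IsSmoothProjective n X) :
    (∀ v : bettiCohomology X 2, ofRatClass (ComplexPoints X) 2 v ∈ algebraicClasses X 1) ↔ (BettiUniverse.hodge hHD hX 2).hodgeNumber 2 0 = 0 := by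
  refine ⟨fun h => (BettiUniverse.hodgeClasses_hodge_two_eq_top_iff hHD hX).1 ?_, fun h20 => ofRatClass_mem_algebraicClasses_one_of_pg_zero hHD hX h20⟩
  exact BettiUniverse.hodgeClasses_hodge_eq_top_of_forall_mem_algebraicClasses hHD hX 1 h

/-- **`H^{2n−2}(X(ℂ); ℚ)` consists of curve classes ⟺ `p_g(X) = 0`** (`n ≥ 1`; ⟸: g24-#5; ⟹: curve classes are of type `(n−1, n−1)`, and duality).
[cite: VoisinHodgeI2002, §11.1.2 Prop. 11.20, Thm. 6.25 and §6.3.2 proof of Thm. 6.33] [cite: KerrPearlstein2011, §3.1] -/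
theorem forall_ofRatClass_mem_algebraicClasses_curveDegree_iff_pg_zero (hHD : exists_isReal_hodgeModel) (hX : IsSmoothProjective n X) (hn : 1 ≤ n) :
    (∀ v : bettiCohomology X (2 * (n - 1)), ofRatClass (ComplexPoints X) (2 * (n - 1)) v ∈ algebraicClasses X (n - 1)) ↔
      (BettiUniverse.hodge hHD hX 2).hodgeNumber 2 0 = 0 := by
  refine ⟨fun h => (BettiUniverse.hodgeClasses_hodge_curveDegree_eq_top_iff hHD hX hn).1 ?_,
    fun h20 => ofRatClass_mem_algebraicClasses_curveDegree_of_pg_zero hHD hX hn h20⟩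
  exact BettiUniverse.hodgeClasses_hodge_eq_top_of_forall_mem_algebraicClasses hHD hX (n - 1) h

end Literature.AlgebraicGeometry.HodgeTheory

end
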